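import Literature.NumberTheory.LFunctions.ZetaCertifiedEvaluation
import Literature.NumberTheory.LFunctions.MertensZeroCertificate
import Literature.NumberTheory.LFunctions.MertensCertificateData
import HarnessLib

/-!
# The certified computation behind Odlyzko–te Riele's disproof of the Mertens conjecture

Trunk T-ANT (NumberTheory/LFunctions). This file defines the executable *checkers* whose
acceptance (evaluated by `native_decide` in the block files `MertensCertificate/Chunk*.lean`,
`MertensCertificate/Top.lean`) discharges the named fact `Literature.NumberTheory.LFunctions.OdlyzkoTeRiele1985_numerics`
(`MertensConjectureDisproof.lean`): with `T₀ = 2516` and the two values `y₊`, `y₋` of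
[OdlyzkoTeRiele1985, Table 3, lines 15 and 21],

* every zero `ρ` of `ζ` with `0 < Re ρ < 1`, `|Im ρ| < T₀` is simple and on the critical line,
* `h_K(y₊) > 1.06` and `h_K(y₋) < -1.009` for `k(t) = g(t/T₀)`, `g` the Jurkat–Peyerimhoff kernel,

and proves their **soundness** once and for all (`numerics_of_checks`). The mathematics is in
`MertensZeroCertificate.lean`; the arithmetic is the certified evaluator `zetaBox`
(`ZetaCertifiedEvaluation.lean`) at scale `2^330` (`N = 1000`, `ν = 150`; about `90` digits) for
the zeros and at scale `2^110` (`N = 600`, `ν = 25`) for the top edge; the data (claimed zero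
brackets `a_j 2^{-240}`, block bounds, top-edge pieces) are in `MertensCertificateData.lean` and
are *verified*, never trusted.

## The checks

* `checkChunk k` (`k < 20`): for the zeros `j = 100k, …, 100k+99`: ordering of the brackets
  (`2 ≤ t₁ⱼ`, `t₂ⱼ < t₁ⱼ₊₁`, `t₂ⱼ < T₀`), the twisted sign test
  `Re (ζ(½+it₁ⱼ) conj ζ(½+it₂ⱼ)) < 0` (so `ζ(½+iγⱼ) = 0` for some `γⱼ ∈ [t₁ⱼ, t₂ⱼ]`,
  `exists_zero_Icc_of_re_mul_conj_neg'`), and enclosures of the summands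
  `2 Re [k(γ) e^{iγy} / (ρ ζ'(ρ))]` valid for *every* `γ ∈ [t₁ⱼ, t₂ⱼ]` (`ζ'(ρ)` from the slope,
  `norm_deriv_riemannZeta_sub_slope_le`), summed and compared with `chunkBounds[k]`.
* `checkTop`: the winding certificate `topPieces` for `ζ(x + iT₀)`, `½ ≤ x ≤ 2` (each piece one
  evaluation of `zetaBox` on a box), last endpoint `2`, last label `0`, and the Stirling inequality
  of `zetaZeroCount_eq_of_hpieces_stirling` with `n = 2000`.
* `checkFinal`: `Σ L_k > 1.06 · 2^60`, `Σ U_k < -1.009 · 2^60`.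

The tables `tablesZ`, `tablesT` and the three checks are marked `irreducible` (after their soundness
lemmas), as in `LiouvilleSieve.lean`: tactics must never evaluate them by reduction.

## Main result

* `numerics_of_checks : checkTop = true → checkFinal = true → (∀ k < 20, checkChunk k = true) →
  OdlyzkoTeRiele1985_numerics`.

## References

* A. M. Odlyzko, H. J. J. te Riele, *Disproof of the Mertens conjecture*, J. reine angew. Math.
  357 (1985), 138–160, §4 and Table 3. [OdlyzkoTeRiele1985]
* R. P. Brent, *On the zeros of the Riemann zeta function in the critical strip*, Math. Comp. 33
  (1979), 1361–1372. [Brent1979]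
-/

open Finset Complex
open Literature.Analysis.ValidatedNumerics.NumericsMP Literature.NumberTheory.LFunctions.ZetaNumerics Literature.NumberTheory.LFunctions Literature.NumberTheory.LFunctions.MertensZeroCertificate

namespace Literature.NumberTheory.LFunctions.ZetaNumerics.Mertens

/-! ## Parameters and the objects of the statement -/

/-- Scale `2^330` for the evaluations near the zeros. [folklore] -/
def SZ : ℕ := 2 ^ 330

/-- Scale `2^110` for the top edge. [folklore] -/
def ST : ℕ := 2 ^ 110

/-- Tables for the zeros: `N = 1000`, `ν = 150`. [folklore] -/
def tablesZ : Option Tables := mkTables SZ 1000 150 30 370 90 42 6 34 8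

/-- Tables for the top edge: `N = 600`, `ν = 25`. [folklore] -/
def tablesT : Option Tables := mkTables ST 600 25 24 140 40 30 4 16 6

/-- Number of zeros. [folklore] -/
def NZ : ℕ := 2000

/-- Block length. [folklore] -/
def CHUNK : ℕ := 100

/-- Number of blocks. [folklore] -/
def NCHUNK : ℕ := 20

/-- The claimed bracket integer `a_j`. [folklore] -/
def ordinate (j : ℕ) : ℤ := ordinates.getD j 0

/-- `t₁ⱼ = a_j 2^{-240}`. [folklore] -/
noncomputable def t₁ (j : ℕ) : ℝ := (ordinate j : ℝ) / 2 ^ 240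

/-- `t₂ⱼ = (a_j + 1) 2^{-240}`. [folklore] -/
noncomputable def t₂ (j : ℕ) : ℝ := ((ordinate j : ℝ) + 1) / 2 ^ 240

/-- `y₊`. [cite: OdlyzkoTeRiele1985, §4.3 Table 3 line 15 p. 155] -/
noncomputable def yPlus : ℝ := (yPlusNum : ℝ) / yDen

/-- `y₋`. [cite: OdlyzkoTeRiele1985, §4.3 Table 3 line 21 p. 155] -/
noncomputable def yMinus : ℝ := (yMinusNum : ℝ) / yDen

/-- The kernel transform `k(t) = g(t/T₀)`. [cite: OdlyzkoTeRiele1985, §4.1 (4.1) p. 150] -/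
noncomputable def kT (t : ℝ) : ℂ := (jurkatPeyerimhoffKernel (t / heightT0) : ℂ)

/-- The summand `2 Re [k(γ) e^{iγy} / (ρ ζ'(ρ))]`, `ρ = ½ + iγ`. [cite: OdlyzkoTeRiele1985, Theorem p. 144 (display after (2.18))] -/
noncomputable def otrTerm (y γ : ℝ) : ℝ :=
  2 * (kT γ * cexp (I * (γ * y)) / ((1 / 2 + γ * I) * deriv riemannZeta (1 / 2 + γ * I))).re

/-! ## The checkers -/

/-- The exact interval `½` at scale `SZ`. [folklore] -/
def halfZ : MI := MI.ofFrac SZ 1 2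

/-- Upper bound, at scale `S²` and *exactly* (no rounding), for `x · y` over two intervals: the
largest corner product. (The twisted sign `Re (ζ₁ conj ζ₂) ≈ −10⁻¹⁴⁵` is far below one unit
`2^{-330}` in the last place, so it must not be rounded.) [folklore] -/
def mulExactHi (I J : MI) : ℤ := max (max (I.lo * J.lo) (I.lo * J.hi)) (max (I.hi * J.lo) (I.hi * J.hi))

/-- Widening of the slope enclosing `ζ'(ρ)`: `2^90 · 4 (T₀ + 4)³ ≥ (t₂−t₁)·4(t₂+4)³·SZ`. [folklore] -/
def rSlope : ℤ := 2 ^ 90 * 4 * ((heightT0 : ℤ) + 4) ^ 3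

/-- Enclosure of `g(u)`, `u = γ/T₀`, for `γ` in the interval `G` (`0 ≤ u ≤ 1`):
`g(u) = (1 − u) cos(πu) + sin(πu)/π`. [cite: OdlyzkoTeRiele1985, §4.1 (4.1) p. 150] -/
def kernelBox (T : Tables) (G : MI) : Option MI :=
  let U := G.divNat heightT0
  match MC.expI SZ T.KI T.kI T.piI (MI.mul SZ U T.piI) with
  | none => none
  | some E =>
    match MI.divPos SZ E.im T.piI with
    | none => none
    | some sdiv => some ((MI.mul SZ ((MI.ofInt SZ 1).sub U) E.re).add sdiv)

/-- Enclosure of `2 Re [e^{iγy} g / Den]` for `γ ∈ G`, `y = yNum/yDen`. [folklore] -/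
def termBox (T : Tables) (G g : MI) (Den : MC) (yNum : ℤ) : Option MI :=
  match MC.expI SZ T.KI T.kI T.piI ((G.mulInt yNum).divNat yDen) with
  | none => none
  | some E2 =>
    match MC.divBox SZ (E2.mulMI SZ g) Den with
    | none => none
    | some F => some (F.re.mulInt 2)

/-- The per-zero computation: from the bracket integer `a`, the two values `ζ(½+it₁)`,
`ζ(½+it₂)`, the twisted sign, the slope `−i(Z₂−Z₁)2^{240}` widened to contain `ζ'(ρ)`, and the
bounds `(lo, hi)` of the summands at `y₊`, `y₋` (scaled by `SZ`). [folklore] -/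
def zeroTerm (T : Tables) (a : ℤ) : Option (Bool × ℤ × ℤ) :=
  let G : MI := ⟨a * 2 ^ 90, (a + 1) * 2 ^ 90⟩
  match zetaBox T ⟨halfZ, MI.ofScaled (a * 2 ^ 90)⟩,
    zetaBox T ⟨halfZ, MI.ofScaled ((a + 1) * 2 ^ 90)⟩ with
  | some Z1, some Z2 =>
    let tw : ℤ := mulExactHi Z1.re Z2.re + mulExactHi Z1.im Z2.im   -- ≥ Re (ζ₁ conj ζ₂) · SZ²
    let D := (MC.mulNegI ((Z2.sub Z1).mulInt (2 ^ 240))).widen rSlope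
    let Den := MC.mul SZ ⟨halfZ, G⟩ D
    match kernelBox T G with
    | none => none
    | some g =>
      match termBox T G g Den yPlusNum, termBox T G g Den yMinusNum with
      | some FP, some FM => some (decide (tw < 0), FP.lo, FM.hi)
      | _, _ => none
  | _, _ => none

/-- Ordering of the brackets: `2 ≤ t₁ⱼ`, `t₂ⱼ < T₀`, `t₂ⱼ < t₁ⱼ₊₁` (if `j + 1 < 2000`). [folklore] -/
def orderOk (j : ℕ) : Bool :=
  decide (2 * 2 ^ 240 ≤ ordinate j ∧ ordinate j + 1 < (heightT0 : ℤ) * 2 ^ 240 ∧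
    (j + 1 < NZ → ordinate j + 1 < ordinate (j + 1)))

/-- Accumulated sums `(Σ lo, Σ hi)` over the first `i` zeros of block `k`, `none` on any failure.
[folklore] -/
def chunkSums (T : Tables) (k : ℕ) : ℕ → Option (ℤ × ℤ)
  | 0 => some (0, 0)
  | i + 1 =>
    match chunkSums T k i with
    | none => none
    | some (sl, sh) =>
      if orderOk (k * CHUNK + i) then
        match zeroTerm T (ordinate (k * CHUNK + i)) with
        | some (true, vlo, vhi) => some (sl + vlo, sh + vhi)
        | _ => none
      else none

/-- Comparison of the accumulated sums of block `k` with the claimed bounds `(L_k, U_k)`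
(scaled from `2^60` to `SZ = 2^330`). [folklore] -/
def boundsOk (k : ℕ) : Option (ℤ × ℤ) → Bool
  | none => false
  | some (sl, sh) =>
    decide ((chunkBounds.getD k (0, 0)).1 * 2 ^ 270 ≤ sl ∧ sh ≤ (chunkBounds.getD k (0, 0)).2 * 2 ^ 270)

/-- Block check `k` with given tables. [folklore] -/
def checkChunkWith (T : Tables) (k : ℕ) : Bool := boundsOk k (chunkSums T k CHUNK)

/-- **Block check `k`**. (Made irreducible at the end of this file, so that elaborating a
statement `checkChunk k = true` never unfolds the computation; only `native_decide` evaluates it.)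
[folklore] -/
def checkChunk (k : ℕ) : Bool := (tablesZ.map fun T ↦ checkChunkWith T k).getD false

/-- The sum of the claimed lower bounds `L_k`. [folklore] -/
def sumL : ℤ := ∑ k ∈ Finset.range NCHUNK, (chunkBounds.getD k (0, 0)).1

/-- The sum of the claimed upper bounds `U_k`. [folklore] -/
def sumU : ℤ := ∑ k ∈ Finset.range NCHUNK, (chunkBounds.getD k (0, 0)).2

/-- **Final check**: `Σ L_k > 1.06 · 2^60` and `Σ U_k < −1.009 · 2^60`. [folklore] -/
def checkFinal : Bool := decide (106 * 2 ^ 60 < 100 * sumL ∧ 1000 * sumU < -1009 * 2 ^ 60)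

/-- The half-plane condition for label `d` read off a box: `Re (qrot d · z) > 0` on the box.
[folklore] -/
def labelOk (d : Fin 4) (Z : MC) : Bool :=
  match d with
  | 0 => decide (0 < Z.re.lo)
  | 1 => decide (0 < Z.im.lo)
  | 2 => decide (Z.re.hi < 0)
  | 3 => decide (Z.im.hi < 0)

/-- The box `[x₀, x₁]/2¹² × {T₀}` at scale `ST` (`ST/2¹²` is an integer). [folklore] -/
def topBox (x0 x1 : ℕ) : MC :=
  ⟨⟨(x0 : ℤ) * (ST / 4096 : ℕ), (x1 : ℤ) * (ST / 4096 : ℕ)⟩, MI.ofInt ST heightT0⟩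

/-- Check of a piece list along the top edge from `x₀/2¹²`: boxes `[x₀, x₁]/2¹² × {T₀}`.
[folklore] -/
def checkPieces (T : Tables) : ℕ → List (ℕ × Fin 4) → Bool
  | _, [] => true
  | x0, (x1, d) :: ps =>
    decide (x0 ≤ x1) &&
    (match zetaBox T (topBox x0 x1) with
      | none => false
      | some Z => labelOk d Z) &&
    checkPieces T x1 ps

/-- The last endpoint of an integer piece list. [folklore] -/
def lastX (x0 : ℕ) : List (ℕ × Fin 4) → ℕ
  | [] => x0
  | (x1, _) :: ps => lastX x1 ps

/-- The last label of an integer piece list (computable copy of `piecesLastDir`). [folklore] -/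
def lastDirN (d : Fin 4) : List (ℕ × Fin 4) → Fin 4
  | [] => d
  | (_, d') :: ps => lastDirN d' ps

/-- The signed quarter turns of an integer piece list (computable copy of `piecesTurns`).
[folklore] -/
def turnsN (d : Fin 4) : List (ℕ × Fin 4) → ℤ
  | [] => 0
  | (_, d') :: ps => Literature.Analysis.Complex.qturn d d' + turnsN d' ps

/-- Enclosure check of the Stirling inequality
`|M(T₀)/π + 1 − turns/2 − 2000| + 2K(¼)/(πT₀) ≤ ½`, `M(T) = (T/2)log(T/2π) − T/2 − π/8`,
`K(¼) = 1/6 + π/12 + 1/32 + 1/8`, at scale `ST`. [folklore] -/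
def checkStirling (T : Tables) (turns : ℤ) : Bool :=
  let S := ST
  let piI := T.piI
  match MI.logNat S 140 heightT0, MI.logTwo S 140, MI.divPos S (MI.ofInt S 3) piI with
  | some lT, some l2, some q =>
    -- log π = log 3 − log (1 − (1 − 3/π))
    match MI.logNat S 140 3, MI.logOneSub S 140 ((MI.ofInt S 1).sub q) with
    | some l3, some lq =>
      let lpi := l3.sub lq
      let L := (lT.sub l2).sub lpi                                  -- log (T₀/2π)
      let M := ((MI.mul S L (MI.ofFrac S heightT0 2)).sub (MI.ofFrac S heightT0 2)).sub (piI.divNat 8)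
      match MI.divPos S M piI with
      | none => false
      | some Mpi =>
        let W := ((Mpi.add (MI.ofInt S 1)).sub (MI.ofFrac S turns 2)).sub (MI.ofInt S 2000)
        let K := ((MI.ofFrac S 1 6).add (MI.ofFrac S 5 32)).add (piI.divNat 12)
        match MI.divPos S (K.mulInt 2) (MI.mul S piI (MI.ofInt S heightT0)) with
        | none => false
        | some R => decide (2 * (W.absHi + R.hi) ≤ (S : ℤ))
    | _, _ => false
  | _, _, _ => false

/-- Top-edge check with given tables and piece list. [folklore] -/
def checkTopWith (T : Tables) : List (ℕ × Fin 4) → Bool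
  | [] => false
  | (x1, d1) :: ps =>
    checkPieces T 2048 ((x1, d1) :: ps) && decide (lastX x1 ps = 8192) &&
      decide (lastDirN d1 ps = 0) && checkStirling T (turnsN d1 ps)

/-- **Top-edge check**. (Made irreducible at the end of this file.) [folklore] -/
def checkTop : Bool := (tablesT.map fun T ↦ checkTopWith T topPieces).getD false


/-! ## Soundness -/

section Soundness

open Literature.Analysis.Complex (HPieces qrot piecesLast piecesLastDir piecesTurns)

/-- [folklore] -/
lemma SZ_pos : 0 < SZ := by unfold SZ; positivity
/-- [folklore] -/
lemma ST_pos : 0 < ST := by unfold ST; positivity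
/-- `SZ = 2^240 · 2^90`. [folklore] -/
lemma SZ_eq : (SZ : ℝ) = 2 ^ 240 * 2 ^ 90 := by
  unfold SZ; rw [Nat.cast_pow, Nat.cast_ofNat, ← pow_add]
/-- [folklore] -/
lemma heightT0_pos : 0 < heightT0 := by unfold heightT0; norm_num
/-- [folklore] -/
lemma heightT0_real : (heightT0 : ℝ) = 2516 := by unfold heightT0; norm_num
/-- [folklore] -/
lemma yDen_pos : 0 < yDen := by unfold yDen; norm_num

/-- `mkTables` records the scale it is given. [folklore] -/
lemma mkTables_S {S N nu guard Klog Kpi Kexp kexp KI kI : ℕ} {T : Tables}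
    (h : mkTables S N nu guard Klog Kpi Kexp kexp KI kI = some T) : T.S = S := by
  unfold mkTables at h
  simp only at h
  split_ifs at h
  split at h
  · simp only [Option.some.injEq] at h
    subst h; rfl
  · simp at h

/-- The zero tables, when built, are valid. [folklore] -/
lemma tablesZ_valid {T : Tables} (h : tablesZ = some T) : T.Valid := mkTables_valid h

/-- The zero tables have scale `SZ`. [folklore] -/
lemma tablesZ_S {T : Tables} (h : tablesZ = some T) : T.S = SZ := mkTables_S h

/-- The top-edge tables, when built, are valid. [folklore] -/
lemma tablesT_valid {T : Tables} (h : tablesT = some T) : T.Valid := mkTables_valid h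

/-- The top-edge tables have scale `ST`. [folklore] -/
lemma tablesT_S {T : Tables} (h : tablesT = some T) : T.S = ST := mkTables_S h

attribute [irreducible] tablesZ tablesT

/-- Soundness of `mulExactHi`: `x y S² ≤ mulExactHi I J`. [folklore] -/
lemma mul_le_mulExactHi {S : ℕ} {x y : ℝ} {I J : MI} (hx : MI.mem S x I) (hy : MI.mem S y J) :
    x * y * S * S ≤ (mulExactHi I J : ℝ) := by
  obtain ⟨-, h2⟩ := Literature.Analysis.ValidatedNumerics.Numerics.FI.mul_mem_corners hx hy
  unfold mulExactHi
  push_cast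
  nlinarith [h2]

/-! ### The kernel and the summands -/

/-- Soundness of `kernelBox`. [cite: OdlyzkoTeRiele1985, §4.1 (4.1) p. 150] -/
theorem mem_kernelBox {T : Tables} (hT : T.Valid) (hTS : T.S = SZ) {G g : MI}
    (h : kernelBox T G = some g) {γ : ℝ} (hγ : MI.mem SZ γ G) (h0 : 0 ≤ γ)
    (h1 : γ ≤ heightT0) : MI.mem SZ (jurkatPeyerimhoffKernel (γ / heightT0)) g := by
  have hpi : MI.mem SZ Real.pi T.piI := hTS ▸ hT.mem_pi
  unfold kernelBox at h
  simp only at h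
  split at h
  · simp at h
  · rename_i E hE
    split at h
    · simp at h
    · rename_i sdiv hsdiv
      simp only [Option.some.injEq] at h
      subst h
      set u : ℝ := γ / heightT0 with hu
      have hU : MI.mem SZ u (G.divNat heightT0) := MI.mem_divNat hγ heightT0_pos
      have hΦ : MI.mem SZ (u * Real.pi) (MI.mul SZ (G.divNat heightT0) T.piI) :=
        MI.mem_mul SZ_pos hU hpi
      have hEm := MC.mem_expI SZ_pos hpi hE hΦ
      have hcos : MI.mem SZ (Real.cos (u * Real.pi)) E.re := by
        have := hEm.1; rwa [Complex.exp_ofReal_mul_I_re] at this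
      have hsin : MI.mem SZ (Real.sin (u * Real.pi)) E.im := by
        have := hEm.2; rwa [Complex.exp_ofReal_mul_I_im] at this
      have hdiv := MI.mem_divPos SZ_pos hsdiv hsin hpi
      have hone : MI.mem SZ (1 - u) ((MI.ofInt SZ 1).sub (G.divNat heightT0)) := by
        have := MI.mem_sub (MI.mem_ofInt SZ 1) hU; simpa using this
      have hres := MI.mem_add (MI.mem_mul SZ_pos hone hcos) hdiv
      have hu0 : 0 ≤ u := div_nonneg h0 (by positivity)
      have hu1 : u ≤ 1 := by
        rw [hu, div_le_one (by exact_mod_cast heightT0_pos)]; exact h1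
      have hval : jurkatPeyerimhoffKernel u =
          (1 - u) * Real.cos (u * Real.pi) + Real.sin (u * Real.pi) / Real.pi := by
        unfold jurkatPeyerimhoffKernel
        rw [abs_of_nonneg hu0, if_pos hu1, mul_comm Real.pi u]
        ring
      rw [hval]
      exact hres

/-- Soundness of `termBox`: for `γ ∈ G`, `gv ∈ g`, `w ∈ Den`,
`2 Re [e^{iγy} gv / w] ∈ termBox` (`y = yNum / yDen`). [folklore] -/
theorem mem_termBox {T : Tables} (hT : T.Valid) (hTS : T.S = SZ) {G g : MI} {Den : MC} {yNum : ℤ}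
    {F : MI} (h : termBox T G g Den yNum = some F) {γ : ℝ} (hγ : MI.mem SZ γ G) {gv : ℝ}
    (hg : MI.mem SZ gv g) {w : ℂ} (hw : MC.mem SZ w Den) :
    MI.mem SZ ((cexp (((γ * ((yNum : ℝ) / yDen) : ℝ) : ℂ) * I) * (gv : ℂ) / w).re * 2) F := by
  have hpi : MI.mem SZ Real.pi T.piI := hTS ▸ hT.mem_pi
  unfold termBox at h
  split at h
  · simp at h
  · rename_i E2 hE2
    split at h
    · simp at h
    · rename_i F' hF'
      simp only [Option.some.injEq] at h
      subst h
      have hΘ : MI.mem SZ (γ * ((yNum : ℝ) / yDen)) ((G.mulInt yNum).divNat yDen) := by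
        have := MI.mem_divNat (MI.mem_mulInt hγ yNum) yDen_pos
        convert this using 1; ring
      have hE := MC.mem_expI SZ_pos hpi hE2 hΘ
      have hP := MC.mem_mulMI SZ_pos hE hg
      have hF := MC.mem_divBox SZ_pos hF' hP hw
      exact MI.mem_mulInt hF.1 2

/-- The summand in the form produced by the checker. [folklore] -/
lemma otrTerm_eq (y γ : ℝ) :
    otrTerm y γ = (cexp (((γ * y : ℝ) : ℂ) * I) * (jurkatPeyerimhoffKernel (γ / heightT0) : ℂ) /
      ((1 / 2 + γ * I) * deriv riemannZeta (1 / 2 + γ * I))).re * 2 := by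
  unfold otrTerm kT
  rw [mul_comm (2 : ℝ)]
  congr 3
  rw [mul_comm]
  congr 2
  push_cast; ring

/-! ### One zero -/

/-- Membership of `½ + it` in the input boxes. [folklore] -/
lemma mem_inputBox {a : ℤ} {t : ℝ} (ht : t = (a : ℝ) / 2 ^ 240) :
    MC.mem SZ (1 / 2 + t * I) ⟨halfZ, MI.ofScaled (a * 2 ^ 90)⟩ := by
  have hre : ((1 : ℂ) / 2 + t * I).re = (1 : ℤ) / (2 : ℕ) := by simp
  have him : ((1 : ℂ) / 2 + t * I).im = t := by simp
  constructor
  · rw [hre]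
    exact MI.mem_ofFrac SZ 1 (q := 2) (by norm_num)
  · rw [him, ht]
    have := MI.mem_ofScaled SZ_pos (a * 2 ^ 90)
    convert this using 1
    rw [SZ_eq]
    push_cast
    field_simp
    ring

/-- The `γ`-interval of a bracket. [folklore] -/
lemma mem_bracket {a : ℤ} {γ : ℝ} (hγ : γ ∈ Set.Icc ((a : ℝ) / 2 ^ 240) (((a : ℝ) + 1) / 2 ^ 240)) :
    MI.mem SZ γ ⟨a * 2 ^ 90, (a + 1) * 2 ^ 90⟩ := by
  obtain ⟨h1, h2⟩ := hγ
  rw [div_le_iff₀ (by positivity)] at h1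
  rw [le_div_iff₀ (by positivity)] at h2
  have hp : (0 : ℝ) ≤ 2 ^ 90 := by positivity
  constructor
  · simp only [Int.cast_mul, Int.cast_pow, Int.cast_ofNat]
    rw [SZ_eq, ← mul_assoc]
    exact mul_le_mul_of_nonneg_right h1 hp
  · simp only [Int.cast_mul, Int.cast_pow, Int.cast_ofNat, Int.cast_add, Int.cast_one]
    rw [SZ_eq, ← mul_assoc]
    exact mul_le_mul_of_nonneg_right h2 hp

/-- **Soundness of the per-zero computation.** With `t₁ = a 2^{-240}`, `t₂ = (a+1) 2^{-240}`,
`2 ≤ t₁`, `t₂ < T₀`: the twisted sign certifies a zero `½ + iγ`, `t₁ ≤ γ ≤ t₂`, and for every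
`γ ∈ [t₁, t₂]` the summands at `y₊`, `y₋` are bounded by `lo / SZ`, `hi / SZ`. [folklore] -/
theorem zeroTerm_sound {T : Tables} (hT : T.Valid) (hTS : T.S = SZ) {a : ℤ}
    (ha2 : 2 * 2 ^ 240 ≤ a) (haT : a + 1 < (heightT0 : ℤ) * 2 ^ 240) {b : Bool} {vlo vhi : ℤ}
    (h : zeroTerm T a = some (b, vlo, vhi)) :
    (b = true → ∃ γ : ℝ, γ ∈ Set.Icc ((a : ℝ) / 2 ^ 240) (((a : ℝ) + 1) / 2 ^ 240) ∧
        riemannZeta (1 / 2 + γ * I) = 0) ∧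
      ∀ γ : ℝ, γ ∈ Set.Icc ((a : ℝ) / 2 ^ 240) (((a : ℝ) + 1) / 2 ^ 240) →
        (vlo : ℝ) ≤ otrTerm yPlus γ * SZ ∧ otrTerm yMinus γ * SZ ≤ vhi := by
  -- the real numbers
  set t₁' : ℝ := (a : ℝ) / 2 ^ 240 with ht₁
  set t₂' : ℝ := ((a : ℝ) + 1) / 2 ^ 240 with ht₂
  have h2p : (0 : ℝ) < 2 ^ 240 := by positivity
  have ha2r : (2 : ℝ) * 2 ^ 240 ≤ a := by exact_mod_cast ha2
  have haTr : (a : ℝ) + 1 < heightT0 * 2 ^ 240 := by exact_mod_cast haT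
  have ht1 : 2 ≤ t₁' := by rw [ht₁, le_div_iff₀ h2p]; linarith
  have ht12 : t₁' < t₂' := by rw [ht₁, ht₂]; gcongr; linarith
  have ht2T : t₂' < heightT0 := by rw [ht₂, div_lt_iff₀ h2p]; linarith
  have hgap : t₂' - t₁' = 1 / 2 ^ 240 := by rw [ht₁, ht₂]; field_simp; ring
  -- unfold the computation
  unfold zeroTerm at h
  simp only at h
  split at h
  · rename_i Z1 Z2 hZ1 hZ2
    split at h
    · simp at h
    · rename_i g hg
      split at h
      · rename_i FP FM hFP hFM
        simp only [Option.some.injEq, Prod.mk.injEq] at h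
        obtain ⟨hb, hlo, hhi⟩ := h
        -- the two values of `ζ`
        have hs1 : (1 / 2 : ℂ) + t₁' * I ≠ 1 := fun h ↦ by
          have := congrArg Complex.im h; simp at this; linarith
        have hs2 : (1 / 2 : ℂ) + t₂' * I ≠ 1 := fun h ↦ by
          have := congrArg Complex.im h; simp at this; linarith
        have hin1 : MC.mem T.S (1 / 2 + t₁' * I) ⟨halfZ, MI.ofScaled (a * 2 ^ 90)⟩ := by
          rw [hTS]; exact mem_inputBox (a := a) rfl
        have hin2 : MC.mem T.S (1 / 2 + t₂' * I) ⟨halfZ, MI.ofScaled ((a + 1) * 2 ^ 90)⟩ := by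
          rw [hTS]; exact mem_inputBox (a := a + 1) (by rw [ht₂]; push_cast; ring)
        have hm1 := mem_zetaBox hT hin1 hs1 hZ1
        have hm2 := mem_zetaBox hT hin2 hs2 hZ2
        rw [hTS] at hm1 hm2
        refine ⟨fun hbt ↦ ?_, fun γ hγ ↦ ?_⟩
        · -- twisted sign test (exact integer arithmetic)
          rw [← hb] at hbt
          have hlt : mulExactHi Z1.re Z2.re + mulExactHi Z1.im Z2.im < 0 := of_decide_eq_true hbt
          have hlt' : ((mulExactHi Z1.re Z2.re + mulExactHi Z1.im Z2.im : ℤ) : ℝ) < 0 := by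
            exact_mod_cast hlt
          have h1 := mul_le_mulExactHi hm1.1 hm2.1
          have h2 := mul_le_mulExactHi hm1.2 hm2.2
          have hre : (riemannZeta (1 / 2 + t₁' * I) * (starRingEnd ℂ) (riemannZeta (1 / 2 + t₂' * I))).re =
              (riemannZeta (1 / 2 + t₁' * I)).re * (riemannZeta (1 / 2 + t₂' * I)).re +
                (riemannZeta (1 / 2 + t₁' * I)).im * (riemannZeta (1 / 2 + t₂' * I)).im := by
            simp [Complex.mul_re]
          have hSr : (0 : ℝ) < SZ := by exact_mod_cast SZ_pos
          have hneg : (riemannZeta (1 / 2 + t₁' * I) * (starRingEnd ℂ) (riemannZeta (1 / 2 + t₂' * I))).re < 0 := by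
            rw [hre]
            by_contra hge
            push Not at hge
            have : 0 ≤ ((riemannZeta (1 / 2 + t₁' * I)).re * (riemannZeta (1 / 2 + t₂' * I)).re +
                (riemannZeta (1 / 2 + t₁' * I)).im * (riemannZeta (1 / 2 + t₂' * I)).im) * SZ * SZ := by
              positivity
            push_cast at hlt'
            nlinarith
          exact exists_zero_Icc_of_re_mul_conj_neg' (by linarith) ht12.le
            (by rw [heightT0_real] at ht2T; linarith) (by rw [hgap]; norm_num) hneg
        · -- the summands at `γ`
          have hG := mem_bracket hγ
          have hγ0 : 0 ≤ γ := by linarith [hγ.1]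
          have hγT : γ ≤ heightT0 := by linarith [hγ.2]
          have hgm := mem_kernelBox hT hTS hg hG hγ0 hγT
          -- `ζ'(ρ)` from the slope
          have hslope := norm_deriv_riemannZeta_sub_slope_le ht1 ht12 hγ
          have hD0 : MC.mem SZ ((riemannZeta (1 / 2 + t₂' * I) - riemannZeta (1 / 2 + t₁' * I)) /
              ((t₂' - t₁' : ℝ) * I)) (MC.mulNegI ((Z2.sub Z1).mulInt (2 ^ 240))) := by
            have := MC.mem_mulNegI (MC.mem_mulInt (MC.mem_sub hm2 hm1) (2 ^ 240))
            convert this using 1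
            rw [hgap, div_eq_mul_inv, mul_inv, Complex.inv_I]
            push_cast
            ring
          have hD : MC.mem SZ (deriv riemannZeta (1 / 2 + γ * I))
              ((MC.mulNegI ((Z2.sub Z1).mulInt (2 ^ 240))).widen rSlope) := by
            apply MC.mem_widen hD0
            refine (mul_le_mul_of_nonneg_right hslope (by positivity)).trans ?_
            rw [hgap, SZ_eq]
            unfold rSlope
            push_cast
            have h4 : 0 ≤ t₂' + 4 := by linarith
            have hc : (t₂' + 4) ^ 3 ≤ ((heightT0 : ℝ) + 4) ^ 3 :=
              pow_le_pow_left₀ h4 (by linarith) 3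
            have : (1 : ℝ) / 2 ^ 240 * (4 * (t₂' + 4) ^ 3) * (2 ^ 240 * 2 ^ 90) =
                2 ^ 90 * 4 * (t₂' + 4) ^ 3 := by field_simp
            rw [this]
            nlinarith [hc]
          have hρ : MC.mem SZ ((1 / 2 : ℂ) + γ * I) ⟨halfZ, ⟨a * 2 ^ 90, (a + 1) * 2 ^ 90⟩⟩ := by
            constructor
            · have := MI.mem_ofFrac SZ 1 (q := 2) (by norm_num)
              simp only [halfZ]
              convert this using 1; simp
            · simpa using hG
          have hDen := MC.mem_mul SZ_pos hρ hD
          have hP := mem_termBox hT hTS hFP hG hgm hDen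
          have hM := mem_termBox hT hTS hFM hG hgm hDen
          rw [← hlo, ← hhi]
          constructor
          · have := hP.1
            rw [otrTerm_eq]
            unfold yPlus
            exact this
          · have := hM.2
            rw [otrTerm_eq]
            unfold yMinus
            exact this
      · simp at h
  · simp at h

/-! ### One block -/

/-- The ordering check, read in `ℝ`. [folklore] -/
lemma orderOk_sound {j : ℕ} (h : orderOk j = true) :
    2 * 2 ^ 240 ≤ ordinate j ∧ ordinate j + 1 < (heightT0 : ℤ) * 2 ^ 240 ∧
      (j + 1 < NZ → ordinate j + 1 < ordinate (j + 1)) :=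
  of_decide_eq_true h

/-- Soundness of `chunkSums`. [folklore] -/
theorem chunkSums_sound {T : Tables} (hT : T.Valid) (hTS : T.S = SZ) (k : ℕ) :
    ∀ (i : ℕ) {sl sh : ℤ}, chunkSums T k i = some (sl, sh) →
      (∀ i' < i, orderOk (k * CHUNK + i') = true ∧
        ∃ γ ∈ Set.Icc (t₁ (k * CHUNK + i')) (t₂ (k * CHUNK + i')),
          riemannZeta (1 / 2 + γ * I) = 0) ∧
      ∀ γ : ℕ → ℝ, (∀ i' < i, γ (k * CHUNK + i') ∈
          Set.Icc (t₁ (k * CHUNK + i')) (t₂ (k * CHUNK + i'))) →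
        (sl : ℝ) ≤ (∑ i' ∈ Finset.range i, otrTerm yPlus (γ (k * CHUNK + i'))) * SZ ∧
          (∑ i' ∈ Finset.range i, otrTerm yMinus (γ (k * CHUNK + i'))) * SZ ≤ sh
  | 0, sl, sh, h => by
    simp only [chunkSums, Option.some.injEq, Prod.mk.injEq] at h
    obtain ⟨rfl, rfl⟩ := h
    refine ⟨fun i' hi' ↦ absurd hi' (Nat.not_lt_zero _), fun γ _ ↦ by simp⟩
  | i + 1, sl, sh, h => by
    simp only [chunkSums] at h
    split at h
    · simp at h
    · rename_i sl0 sh0 hprev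
      split_ifs at h with hord
      split at h
      · rename_i vlo vhi hz
        simp only [Option.some.injEq, Prod.mk.injEq] at h
        obtain ⟨rfl, rfl⟩ := h
        obtain ⟨ih1, ih2⟩ := chunkSums_sound hT hTS k i hprev
        obtain ⟨ha2, haT, -⟩ := orderOk_sound hord
        obtain ⟨hex, hbd⟩ := zeroTerm_sound hT hTS ha2 haT hz
        have ht1 : t₁ (k * CHUNK + i) = (ordinate (k * CHUNK + i) : ℝ) / 2 ^ 240 := rfl
        have ht2 : t₂ (k * CHUNK + i) = ((ordinate (k * CHUNK + i) : ℝ) + 1) / 2 ^ 240 := rfl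
        refine ⟨fun i' hi' ↦ ?_, fun γ hγ ↦ ?_⟩
        · rcases Nat.lt_succ_iff_lt_or_eq.1 hi' with hlt | heq
          · exact ih1 i' hlt
          · subst heq
            exact ⟨hord, by rw [ht1, ht2]; exact hex rfl⟩
        · obtain ⟨hs1, hs2⟩ := ih2 γ fun i' hi' ↦ hγ i' (Nat.lt_succ_of_lt hi')
          have hγi := hγ i (Nat.lt_succ_self i)
          rw [ht1, ht2] at hγi
          obtain ⟨hb1, hb2⟩ := hbd (γ (k * CHUNK + i)) hγi
          rw [Finset.sum_range_succ, Finset.sum_range_succ, add_mul, add_mul]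
          push_cast
          constructor <;> linarith
      · simp at h

set_option exponentiation.threshold 512 in
/-- What a passed block check (with valid tables at scale `SZ`) gives. [folklore] -/
theorem checkChunkWith_sound {T : Tables} (hT : T.Valid) (hTS : T.S = SZ) {k : ℕ}
    (h : checkChunkWith T k = true) :
    (∀ i < CHUNK, orderOk (k * CHUNK + i) = true ∧
      ∃ γ ∈ Set.Icc (t₁ (k * CHUNK + i)) (t₂ (k * CHUNK + i)), riemannZeta (1 / 2 + γ * I) = 0) ∧
    ∀ γ : ℕ → ℝ, (∀ i < CHUNK, γ (k * CHUNK + i) ∈ Set.Icc (t₁ (k * CHUNK + i)) (t₂ (k * CHUNK + i))) →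
      ((chunkBounds.getD k (0, 0)).1 : ℝ) / 2 ^ 60 ≤ ∑ i ∈ Finset.range CHUNK, otrTerm yPlus (γ (k * CHUNK + i)) ∧
        ∑ i ∈ Finset.range CHUNK, otrTerm yMinus (γ (k * CHUNK + i)) ≤ ((chunkBounds.getD k (0, 0)).2 : ℝ) / 2 ^ 60 := by
  unfold checkChunkWith at h
  generalize hcs : chunkSums T k CHUNK = r at h
  rcases r with _ | ⟨sl, sh⟩
  · simp [boundsOk] at h
  · simp only [boundsOk, decide_eq_true_eq] at h
    have hdec := h
    obtain ⟨h1, h2⟩ := chunkSums_sound hT hTS k CHUNK hcs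
    refine ⟨h1, fun γ hγ ↦ ?_⟩
    obtain ⟨hs1, hs2⟩ := h2 γ hγ
    have hSZ : (SZ : ℝ) = 2 ^ 60 * 2 ^ 270 := by
      unfold SZ; rw [Nat.cast_pow, Nat.cast_ofNat, ← pow_add]
    have e1 : (((chunkBounds.getD k (0, 0)).1 : ℤ) : ℝ) * 2 ^ 270 ≤ sl := by
      have := Int.cast_le (R := ℝ) |>.2 hdec.1
      simp only [Int.cast_mul, Int.cast_pow, Int.cast_ofNat] at this
      linarith
    have e2 : (sh : ℝ) ≤ (((chunkBounds.getD k (0, 0)).2 : ℤ) : ℝ) * 2 ^ 270 := by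
      have := Int.cast_le (R := ℝ) |>.2 hdec.2
      simp only [Int.cast_mul, Int.cast_pow, Int.cast_ofNat] at this
      linarith
    rw [hSZ] at hs1 hs2
    have hp : (0 : ℝ) < 2 ^ 270 := by positivity
    constructor
    · rw [div_le_iff₀ (by positivity)]
      have key : (((chunkBounds.getD k (0, 0)).1 : ℤ) : ℝ) * 2 ^ 270 ≤
          (∑ i ∈ Finset.range CHUNK, otrTerm yPlus (γ (k * CHUNK + i))) * 2 ^ 60 * 2 ^ 270 := by
        linarith
      exact le_of_mul_le_mul_right key hp
    · rw [le_div_iff₀ (by positivity)]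
      have key : (∑ i ∈ Finset.range CHUNK, otrTerm yMinus (γ (k * CHUNK + i))) * 2 ^ 60 * 2 ^ 270 ≤
          (((chunkBounds.getD k (0, 0)).2 : ℤ) : ℝ) * 2 ^ 270 := by
        linarith
      exact le_of_mul_le_mul_right key hp

/-- What a passed block check gives. [folklore] -/
theorem checkChunk_sound {k : ℕ} (h : checkChunk k = true) :
    (∀ i < CHUNK, orderOk (k * CHUNK + i) = true ∧
      ∃ γ ∈ Set.Icc (t₁ (k * CHUNK + i)) (t₂ (k * CHUNK + i)), riemannZeta (1 / 2 + γ * I) = 0) ∧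
    ∀ γ : ℕ → ℝ, (∀ i < CHUNK, γ (k * CHUNK + i) ∈ Set.Icc (t₁ (k * CHUNK + i)) (t₂ (k * CHUNK + i))) →
      ((chunkBounds.getD k (0, 0)).1 : ℝ) / 2 ^ 60 ≤ ∑ i ∈ Finset.range CHUNK, otrTerm yPlus (γ (k * CHUNK + i)) ∧
        ∑ i ∈ Finset.range CHUNK, otrTerm yMinus (γ (k * CHUNK + i)) ≤ ((chunkBounds.getD k (0, 0)).2 : ℝ) / 2 ^ 60 := by
  unfold checkChunk at h
  generalize hTab : tablesZ = o at h
  rcases o with _ | T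
  · simp at h
  · simp only [Option.map_some, Option.getD_some] at h
    exact checkChunkWith_sound (tablesZ_valid hTab) (tablesZ_S hTab) h

/-! ### The top edge -/

/-- The real piece list of an integer piece list. [folklore] -/
noncomputable def toRealPieces : List (ℕ × Fin 4) → List (ℝ × Fin 4)
  | [] => []
  | (x, d) :: ps => ((x : ℝ) / 4096, d) :: toRealPieces ps

/-- `piecesLast` of the real piece list. [folklore] -/
lemma piecesLast_toRealPieces : ∀ (x0 : ℕ) (ps : List (ℕ × Fin 4)),
    piecesLast ((x0 : ℝ) / 4096) (toRealPieces ps) = (lastX x0 ps : ℝ) / 4096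
  | x0, [] => rfl
  | x0, (x1, d) :: ps => by
    simp only [toRealPieces, Literature.Analysis.Complex.piecesLast_cons, lastX]
    exact piecesLast_toRealPieces x1 ps

/-- `piecesLastDir` of the real piece list. [folklore] -/
lemma piecesLastDir_toRealPieces : ∀ (d : Fin 4) (ps : List (ℕ × Fin 4)),
    piecesLastDir d (toRealPieces ps) = lastDirN d ps
  | d, [] => rfl
  | d, (x1, d') :: ps => by
    simp only [toRealPieces, Literature.Analysis.Complex.piecesLastDir_cons, lastDirN]
    exact piecesLastDir_toRealPieces d' ps

/-- `piecesTurns` of the real piece list. [folklore] -/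
lemma piecesTurns_toRealPieces : ∀ (d : Fin 4) (ps : List (ℕ × Fin 4)),
    piecesTurns d (toRealPieces ps) = turnsN d ps
  | d, [] => rfl
  | d, (x1, d') :: ps => by
    simp only [toRealPieces, Literature.Analysis.Complex.piecesTurns_cons, turnsN]
    rw [piecesTurns_toRealPieces d' ps]

/-- Soundness of `labelOk`. [folklore] -/
lemma labelOk_sound {d : Fin 4} {Z : MC} (h : labelOk d Z = true) {z : ℂ} (hz : MC.mem ST z Z) :
    0 < (qrot d * z).re := by
  fin_cases d
  · have hlt : 0 < Z.re.lo := of_decide_eq_true h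
    have := MI.pos_of_lo_pos hz.1 hlt
    simpa [qrot] using this
  · have hlt : 0 < Z.im.lo := of_decide_eq_true h
    have := MI.pos_of_lo_pos hz.2 hlt
    simpa [qrot] using this
  · have hlt : Z.re.hi < 0 := of_decide_eq_true h
    have := MI.neg_of_hi_neg hz.1 hlt
    simp [qrot]; linarith
  · have hlt : Z.im.hi < 0 := of_decide_eq_true h
    have := MI.neg_of_hi_neg hz.2 hlt
    simp [qrot]; linarith

/-- `2¹² ∣ ST`. [folklore] -/
lemma ST_div : (ST / 4096 : ℕ) * 4096 = ST := by unfold ST; norm_num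

/-- Membership of `x + iT₀` in `topBox x₀ x₁` for `x₀/2¹² ≤ x ≤ x₁/2¹²`. [folklore] -/
lemma mem_topBox {x0 x1 : ℕ} {x : ℝ} (hx : x ∈ Set.Icc ((x0 : ℝ) / 4096) ((x1 : ℝ) / 4096)) :
    MC.mem ST ((x : ℂ) + (heightT0 : ℝ) * I) (topBox x0 x1) := by
  have hq : ((ST / 4096 : ℕ) : ℝ) * 4096 = ST := by
    rw [show (4096 : ℝ) = ((4096 : ℕ) : ℝ) by norm_num, ← Nat.cast_mul, ST_div]
  constructor
  · simp only [topBox, Complex.add_re, Complex.ofReal_re, Complex.mul_re, Complex.I_re,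
      Complex.I_im, Complex.ofReal_im, mul_zero, zero_mul, sub_zero, add_zero]
    obtain ⟨h1, h2⟩ := hx
    rw [div_le_iff₀ (by norm_num)] at h1
    rw [le_div_iff₀ (by norm_num)] at h2
    have hp : (0 : ℝ) ≤ ((ST / 4096 : ℕ) : ℝ) := by positivity
    constructor
    · simp only [Int.cast_mul, Int.cast_natCast]
      calc (x0 : ℝ) * ((ST / 4096 : ℕ) : ℝ) ≤ x * 4096 * ((ST / 4096 : ℕ) : ℝ) :=
            mul_le_mul_of_nonneg_right h1 hp
        _ = x * ST := by rw [← hq]; ring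
    · simp only [Int.cast_mul, Int.cast_natCast]
      calc x * (ST : ℝ) = x * 4096 * ((ST / 4096 : ℕ) : ℝ) := by rw [← hq]; ring
        _ ≤ (x1 : ℝ) * ((ST / 4096 : ℕ) : ℝ) := mul_le_mul_of_nonneg_right h2 hp
  · simp only [topBox, Complex.add_im, Complex.ofReal_im, Complex.mul_im, Complex.I_re,
      Complex.I_im, Complex.ofReal_re, mul_zero, mul_one, zero_add, add_zero]
    exact_mod_cast MI.mem_ofInt ST (heightT0 : ℤ)

/-- Soundness of `checkPieces`: a valid `HPieces` certificate for `ζ` at height `T₀`.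
[folklore] -/
theorem hpieces_of_checkPieces {T : Tables} (hT : T.Valid) (hTS : T.S = ST) :
    ∀ (x0 : ℕ) (ps : List (ℕ × Fin 4)), checkPieces T x0 ps = true →
      HPieces riemannZeta heightT0 ((x0 : ℝ) / 4096) (toRealPieces ps)
  | x0, [], _ => trivial
  | x0, (x1, d) :: ps, h => by
    simp only [checkPieces, Bool.and_eq_true, decide_eq_true_eq] at h
    obtain ⟨⟨h01, hmid⟩, htail⟩ := h
    simp only [toRealPieces]
    refine ⟨by exact_mod_cast (div_le_div_of_nonneg_right (by exact_mod_cast h01) (by norm_num)), ?_,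
      hpieces_of_checkPieces hT hTS x1 ps htail⟩
    intro x hx
    split at hmid
    · simp at hmid
    · rename_i Z hZ
      have hs : MC.mem T.S ((x : ℂ) + (heightT0 : ℝ) * I) (topBox x0 x1) := hTS ▸ mem_topBox hx
      have hs1 : (x : ℂ) + (heightT0 : ℝ) * I ≠ 1 := fun h ↦ by
        have := congrArg Complex.im h
        simp [heightT0_real] at this
      have hm := mem_zetaBox hT hs hs1 hZ
      rw [hTS] at hm
      exact labelOk_sound hmid hm

/-- Soundness of `checkStirling`. [folklore] -/
theorem stirling_of_checkStirling {T : Tables} (hT : T.Valid) (hTS : T.S = ST) {turns : ℤ}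
    (h : checkStirling T turns = true) :
    |((heightT0 : ℝ) / 2 * Real.log (heightT0 / (2 * Real.pi)) - heightT0 / 2 - Real.pi / 8) / Real.pi + 1 -
        (turns : ℝ) / 2 - (2000 : ℕ)| + 2 * stirlingVertRate (1 / 4) / (Real.pi * heightT0) ≤ 1 / 2 := by
  have hpi : MI.mem ST Real.pi T.piI := hTS ▸ hT.mem_pi
  have hSr : (0 : ℝ) < ST := by exact_mod_cast ST_pos
  unfold checkStirling at h
  simp only at h
  split at h
  · rename_i lT l2 q hlT hl2 hq
    split at h
    · rename_i l3 lq hl3 hlq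
      split at h
      · simp at h
      · rename_i Mpi hMpi
        split at h
        · simp at h
        · rename_i R hR
          have hdec : 2 * ((((Mpi.add (MI.ofInt ST 1)).sub (MI.ofFrac ST turns 2)).sub
              (MI.ofInt ST 2000)).absHi + R.hi) ≤ (ST : ℤ) := of_decide_eq_true h
          -- the enclosures
          have hlogT := MI.mem_logNat ST_pos hlT
          have hlog2 := MI.mem_logTwo ST_pos hl2
          have hlog3 := MI.mem_logNat ST_pos hl3
          have h3pi : MI.mem ST ((3 : ℝ) / Real.pi) q := by
            have := MI.mem_divPos ST_pos hq (MI.mem_ofInt ST 3) hpi; simpa using this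
          have hx : MI.mem ST (1 - 3 / Real.pi) ((MI.ofInt ST 1).sub q) := by
            have := MI.mem_sub (MI.mem_ofInt ST 1) h3pi; simpa using this
          have hlq' := MI.mem_logOneSub ST_pos hlq hx
          have hpi0 : 0 < Real.pi := Real.pi_pos
          have elq : Real.log (1 - (1 - 3 / Real.pi)) = Real.log 3 - Real.log Real.pi := by
            rw [show (1 : ℝ) - (1 - 3 / Real.pi) = 3 / Real.pi by ring,
              Real.log_div (by norm_num) hpi0.ne']
          rw [elq] at hlq'
          have hlpi : MI.mem ST (Real.log Real.pi) (l3.sub lq) := by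
            have := MI.mem_sub hlog3 hlq'
            convert this using 1; push_cast; ring
          have hL : MI.mem ST (Real.log (heightT0 / (2 * Real.pi))) ((lT.sub l2).sub (l3.sub lq)) := by
            have := MI.mem_sub (MI.mem_sub hlogT hlog2) hlpi
            convert this using 1
            rw [Real.log_div (by rw [heightT0_real]; norm_num) (by positivity),
              Real.log_mul (by norm_num) hpi0.ne']
            ring
          have hT2 : MI.mem ST ((heightT0 : ℝ) / 2) (MI.ofFrac ST heightT0 2) := by
            have := MI.mem_ofFrac ST (heightT0 : ℤ) (q := 2) (by norm_num)
            simpa using this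
          set Mv : ℝ := (heightT0 : ℝ) / 2 * Real.log (heightT0 / (2 * Real.pi)) - heightT0 / 2 -
            Real.pi / 8 with hMv
          have hM : MI.mem ST Mv (((MI.mul ST ((lT.sub l2).sub (l3.sub lq)) (MI.ofFrac ST heightT0 2)).sub
              (MI.ofFrac ST heightT0 2)).sub (T.piI.divNat 8)) := by
            have := MI.mem_sub (MI.mem_sub (MI.mem_mul ST_pos hL hT2) hT2)
              (MI.mem_divNat hpi (n := 8) (by norm_num))
            convert this using 1
            rw [hMv]; push_cast; ring
          have hMpi' := MI.mem_divPos ST_pos hMpi hM hpi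
          set Wv : ℝ := Mv / Real.pi + 1 - (turns : ℝ) / 2 - (2000 : ℕ) with hWv
          have hW : MI.mem ST Wv (((Mpi.add (MI.ofInt ST 1)).sub (MI.ofFrac ST turns 2)).sub
              (MI.ofInt ST 2000)) := by
            have := MI.mem_sub (MI.mem_sub (MI.mem_add hMpi' (MI.mem_ofInt ST 1))
              (MI.mem_ofFrac ST turns (q := 2) (by norm_num))) (MI.mem_ofInt ST 2000)
            convert this using 1
            rw [hWv]; push_cast; ring
          have hK : MI.mem ST (stirlingVertRate (1 / 4))
              (((MI.ofFrac ST 1 6).add (MI.ofFrac ST 5 32)).add (T.piI.divNat 12)) := by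
            have := MI.mem_add (MI.mem_add (MI.mem_ofFrac ST 1 (q := 6) (by norm_num))
              (MI.mem_ofFrac ST 5 (q := 32) (by norm_num))) (MI.mem_divNat hpi (n := 12) (by norm_num))
            convert this using 1
            unfold stirlingVertRate; push_cast; ring
          have hRv : MI.mem ST (2 * stirlingVertRate (1 / 4) / (Real.pi * heightT0)) R := by
            have := MI.mem_divPos ST_pos hR (MI.mem_mulInt hK 2)
              (MI.mem_mul ST_pos hpi (MI.mem_ofInt ST (heightT0 : ℤ)))
            convert this using 1; push_cast; ring
          -- read off the bound
          have h1 := MI.abs_le_absHi hW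
          have h2 := hRv.2
          have hdec' : (2 : ℝ) * ((((Mpi.add (MI.ofInt ST 1)).sub (MI.ofFrac ST turns 2)).sub
              (MI.ofInt ST 2000)).absHi + R.hi) ≤ ST := by exact_mod_cast hdec
          have : (|Wv| + 2 * stirlingVertRate (1 / 4) / (Real.pi * heightT0)) * ST ≤ ST / 2 := by
            nlinarith
          have := le_of_mul_le_mul_right (by linarith : (|Wv| + 2 * stirlingVertRate (1 / 4) /
            (Real.pi * heightT0)) * ST ≤ 1 / 2 * ST) hSr
          simpa [hWv, hMv] using this
    · simp at h
  · simp at h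

/-- **The zero count**: `checkTop = true → N(2516) = 2000`. [cite: Titchmarsh1986, Thm. 9.3] -/
theorem zetaZeroCount_of_checkTop (h : checkTop = true) : zetaZeroCount heightT0 = 2000 := by
  unfold checkTop at h
  generalize hTab : tablesT = o at h
  rcases o with _ | T
  · simp at h
  · simp only [Option.map_some, Option.getD_some] at h
    have hT : T.Valid := tablesT_valid hTab
    have hTS : T.S = ST := tablesT_S hTab
    generalize hps : topPieces = L at h
    rcases L with _ | ⟨⟨x1, d1⟩, ps⟩
    · simp [checkTopWith] at h
    simp only [checkTopWith, Bool.and_eq_true, decide_eq_true_eq] at h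
    obtain ⟨⟨⟨hpieces, hlast⟩, hdir⟩, hstir⟩ := h
    have hP := hpieces_of_checkPieces hT hTS 2048 ((x1, d1) :: ps) hpieces
    simp only [toRealPieces] at hP
    have h2048 : ((2048 : ℕ) : ℝ) / 4096 = 1 / 2 := by norm_num
    rw [h2048] at hP
    have hlast' : piecesLast ((x1 : ℝ) / 4096) (toRealPieces ps) = 2 := by
      rw [piecesLast_toRealPieces, hlast]; norm_num
    have hdir' : piecesLastDir d1 (toRealPieces ps) = 0 := by
      rw [piecesLastDir_toRealPieces, hdir]
    have hS := stirling_of_checkStirling hT hTS hstir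
    rw [← piecesTurns_toRealPieces] at hS
    exact zetaZeroCount_eq_of_hpieces_stirling (by rw [heightT0_real]; norm_num) hP hlast' hdir' hS

/-! ### Assembly -/

/-- `Σ_{j < a·b} f j = Σ_{k<a} Σ_{i<b} f (k b + i)`. [folklore] -/
lemma sum_range_mul {M : Type*} [AddCommMonoid M] (f : ℕ → M) (a b : ℕ) :
    ∑ j ∈ Finset.range (a * b), f j = ∑ k ∈ Finset.range a, ∑ i ∈ Finset.range b, f (k * b + i) := by
  induction a with
  | zero => simp
  | succ a ih =>
    rw [Nat.succ_mul, Finset.sum_range_add, ih, Finset.sum_range_succ]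

/-- The final check, read in `ℝ`. [folklore] -/
lemma final_of_checkFinal (h : checkFinal = true) :
    (1.06 : ℝ) < (sumL : ℝ) / 2 ^ 60 ∧ (sumU : ℝ) / 2 ^ 60 < -1.009 := by
  have hd := of_decide_eq_true h
  obtain ⟨h1, h2⟩ := hd
  have h1' : (106 : ℝ) * 2 ^ 60 < 100 * sumL := by exact_mod_cast h1
  have h2' : (1000 : ℝ) * sumU < -1009 * 2 ^ 60 := by exact_mod_cast h2
  constructor
  · rw [lt_div_iff₀ (by positivity)]; norm_num; linarith
  · rw [div_lt_iff₀ (by positivity)]; norm_num; linarith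

/-- **Soundness of the whole certificate**: the three checks imply the numerical fact of
Odlyzko–te Riele (`OdlyzkoTeRiele1985_numerics`) with `T = 2516` and the `y` of Table 3,
lines 15 and 21. [cite: OdlyzkoTeRiele1985, §4.3 Table 3 (lines 15, 21) p. 155, with (4.1) p. 150 and p. 139] -/
theorem numerics_of_checks (hTop : checkTop = true) (hFin : checkFinal = true)
    (hCh : ∀ k < NCHUNK, checkChunk k = true) : OdlyzkoTeRiele1985_numerics := by
  classical
  have hNZ : NZ = NCHUNK * CHUNK := by unfold NZ NCHUNK CHUNK; norm_num
  -- per-zero facts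
  have hfact : ∀ j < NZ, orderOk j = true ∧
      ∃ γ ∈ Set.Icc (t₁ j) (t₂ j), riemannZeta (1 / 2 + γ * I) = 0 := by
    intro j hj
    have hk : j / CHUNK < NCHUNK := by
      rw [hNZ] at hj; exact Nat.div_lt_of_lt_mul (by rwa [mul_comm] at hj)
    have hi : j % CHUNK < CHUNK := Nat.mod_lt _ (by unfold CHUNK; norm_num)
    have := (checkChunk_sound (hCh _ hk)).1 (j % CHUNK) hi
    rwa [Nat.div_add_mod'] at this
  -- the ordinates
  set γ : ℕ → ℝ := fun j ↦ if h : j < NZ then (hfact j h).2.choose else 0 with hγdef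
  have hγ : ∀ j < NZ, γ j ∈ Set.Icc (t₁ j) (t₂ j) ∧ riemannZeta (1 / 2 + γ j * I) = 0 := by
    intro j hj
    have := (hfact j hj).2.choose_spec
    simp only [hγdef, dif_pos hj]
    exact this
  have hord : ∀ j < NZ, 2 ≤ t₁ j ∧ t₂ j < heightT0 ∧ (j + 1 < NZ → t₂ j < t₁ (j + 1)) := by
    intro j hj
    obtain ⟨h1, h2, h3⟩ := orderOk_sound (hfact j hj).1
    have h2p : (0 : ℝ) < 2 ^ 240 := by positivity
    refine ⟨?_, ?_, fun hj1 ↦ ?_⟩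
    · unfold t₁; rw [le_div_iff₀ h2p]; exact_mod_cast h1
    · unfold t₂; rw [div_lt_iff₀ h2p]; exact_mod_cast h2
    · unfold t₁ t₂; rw [div_lt_div_iff_of_pos_right h2p]; exact_mod_cast h3 hj1
  have ht12 : ∀ j, t₁ j < t₂ j := fun j ↦ by
    unfold t₁ t₂; gcongr; linarith
  have hsep : ∀ j j', j < j' → j' < NZ → t₂ j < t₁ j' := by
    intro j j' hjj' hj'
    induction j' with
    | zero => exact absurd hjj' (Nat.not_lt_zero _)
    | succ j' ih =>
      rcases Nat.lt_succ_iff_lt_or_eq.1 hjj' with hlt | heq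
      · have := ih hlt (by omega)
        have h2 := (hord j' (by omega)).2.2 hj'
        linarith [ht12 j']
      · subst heq; exact (hord j (by omega)).2.2 hj'
  have hinj : Set.InjOn γ (Finset.range NZ : Set ℕ) := by
    intro j hj j' hj' h
    simp only [Finset.coe_range, Set.mem_Iio] at hj hj'
    by_contra hne
    rcases lt_or_gt_of_ne hne with hlt | hlt
    · have := hsep j j' hlt hj'
      linarith [(hγ j hj).1.2, (hγ j' hj').1.1]
    · have := hsep j' j hlt hj
      linarith [(hγ j' hj').1.2, (hγ j hj).1.1]
  set Z : Finset ℝ := (Finset.range NZ).image γ with hZdef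
  have hZcard : Z.card = NZ := by
    rw [hZdef, Finset.card_image_of_injOn hinj, Finset.card_range]
  have hZ : ∀ γ' ∈ Z, riemannZeta (1 / 2 + γ' * I) = 0 ∧ 0 < γ' ∧ γ' < heightT0 := by
    intro γ' hγ'
    rw [hZdef, Finset.mem_image] at hγ'
    obtain ⟨j, hj, rfl⟩ := hγ'
    rw [Finset.mem_range] at hj
    obtain ⟨hI, h0⟩ := hγ j hj
    obtain ⟨h1, h2, -⟩ := hord j hj
    exact ⟨h0, by linarith [hI.1], by linarith [hI.2]⟩
  -- the count and the zero clause
  have hN : zetaZeroCount heightT0 = Z.card := by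
    rw [zetaZeroCount_of_checkTop hTop, hZcard]; rfl
  obtain ⟨hclause, hall⟩ := zeros_below_of_count_eq_card Z hZ hN
  have hline : ∀ ρ : ℂ, riemannZeta ρ = 0 → 0 < ρ.re → ρ.re < 1 → |ρ.im| < heightT0 → ρ.re = 1 / 2 :=
    fun ρ h0 h1 h2 h3 ↦ (hclause ρ h0 h1 h2 h3).1
  -- the sums
  have hk_even : ∀ t, kT (-t) = kT t := fun t ↦ by
    unfold kT; rw [neg_div, jurkatPeyerimhoffKernel_neg]
  have hk_real : ∀ t, (starRingEnd ℂ) (kT t) = kT t := fun t ↦ by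
    unfold kT; exact Complex.conj_ofReal _
  have hsum : ∀ y : ℝ, (inghamSum (fun t : ℝ ↦ (jurkatPeyerimhoffKernel (t / heightT0) : ℂ))
      heightT0 y).re = ∑ k ∈ Finset.range NCHUNK, ∑ i ∈ Finset.range CHUNK,
        otrTerm y (γ (k * CHUNK + i)) := by
    intro y
    have h1 := re_inghamSum_eq_sum_of_zeros Z hZ hline hall kT hk_even hk_real y
    change (inghamSum kT heightT0 y).re = _
    rw [h1, hZdef, Finset.sum_image hinj, hNZ, sum_range_mul]
    rfl
  have hbounds : ∀ k < NCHUNK,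
      ((chunkBounds.getD k (0, 0)).1 : ℝ) / 2 ^ 60 ≤ ∑ i ∈ Finset.range CHUNK, otrTerm yPlus (γ (k * CHUNK + i)) ∧
      ∑ i ∈ Finset.range CHUNK, otrTerm yMinus (γ (k * CHUNK + i)) ≤ ((chunkBounds.getD k (0, 0)).2 : ℝ) / 2 ^ 60 := by
    intro k hk
    refine (checkChunk_sound (hCh k hk)).2 γ fun i hi ↦ (hγ _ ?_).1
    rw [hNZ]
    calc k * CHUNK + i < k * CHUNK + CHUNK := by omega
      _ = (k + 1) * CHUNK := by ring
      _ ≤ NCHUNK * CHUNK := Nat.mul_le_mul_right _ hk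
  obtain ⟨hFL, hFU⟩ := final_of_checkFinal hFin
  have hplus : (1.06 : ℝ) < (inghamSum (fun t : ℝ ↦ (jurkatPeyerimhoffKernel (t / heightT0) : ℂ))
      heightT0 yPlus).re := by
    rw [hsum]
    refine hFL.trans_le ?_
    unfold sumL
    push_cast
    rw [Finset.sum_div]
    exact Finset.sum_le_sum fun k hk ↦ (hbounds k (Finset.mem_range.1 hk)).1
  have hminus : (inghamSum (fun t : ℝ ↦ (jurkatPeyerimhoffKernel (t / heightT0) : ℂ))
      heightT0 yMinus).re < -1.009 := by
    rw [hsum]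
    refine lt_of_le_of_lt ?_ hFU
    unfold sumU
    push_cast
    rw [Finset.sum_div]
    exact Finset.sum_le_sum fun k hk ↦ (hbounds k (Finset.mem_range.1 hk)).2
  exact ⟨heightT0, by rw [heightT0_real]; norm_num, hclause, ⟨yPlus, hplus⟩, ⟨yMinus, hminus⟩⟩

end Soundness

/-! The three checks are evaluated only by `native_decide` (block files); make them opaque to the
elaborator so that stating `checkChunk k = true` never unfolds the computation. -/
attribute [irreducible] checkChunk checkTop checkFinal

end Literature.NumberTheory.LFunctions.ZetaNumerics.Mertens
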